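import Literature.Analysis.UnboundedOperators.LinearizedBoltzmannAction
import HarnessLib

/-!
# Grad's splitting of the linearised hard-sphere operator for functions of Gaussian growth

Sibling proof file of `LinearizedBoltzmannAction.lean`, where Grad's splitting
`L g (v) = ∫∫ B (g(v') + g(v_*') - g(v_*)) dω dM(v_*) - ν(v) g(v)` (CIP 1994 §7.2 (2.14)) is
proved for `g` of temperate growth (`hardSphereLinearizedOp_eq_kernel_sub`). The continuous
representative of `L⁻¹ g` in the Chapman–Enskog theory is, a priori, only known to be measurable
with the *Gaussian growth* bound `|ψ(v)| ≤ C e^{|v|²/4}` (the borderline at which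
`ψ M^{1/2} ∈ L^∞`); here we prove the same splitting, **at every `v`**, for such `ψ`
(`hardSphereLinearizedOp_eq_kernel_sub_of_gaussGrowth`): by conservation of energy
`|v'|², |v_*'|² ≤ |v|² + |v_*|²`, the integrand is bounded by
`3 C (1 + |v|) e^{|v|²/4} · (1 + |v_*|) e^{|v_*|²/4}`, which is `dω dM(v_*)`-integrable
(`integrable_integral_sphere_of_gaussBound`). General dimension; no new definitions.
-/

open MeasureTheory Metric Real Set Filter Topology ProbabilityTheory Module
open scoped InnerProductSpace ENNReal

namespace Literature.Analysis.UnboundedOperators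

noncomputable section

open Literature.MathematicalPhysics.KineticTheory (collide sphereMeasure hardSphereKernel
  norm_sq_collide_fst_add_norm_sq_collide_snd)
open Literature.Analysis.FluidPDE

variable {E : Type*} [NormedAddCommGroup E] [InnerProductSpace ℝ E] [FiniteDimensional ℝ E]
  [MeasurableSpace E] [BorelSpace E]

/-! ### Integrability on the sphere and against the Maxwellian under Gaussian growth -/

/-- A measurable integrand on `E × S^{d-1}` bounded in `ω` has integrable sections over the (finite)
sphere measure. [folklore] -/
theorem integrable_sphere_section_of_bound {Φ : E × sphere (0 : E) 1 → ℝ} (hΦ : Measurable Φ)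
    {K : E → ℝ} (hle : ∀ w ω, |Φ (w, ω)| ≤ K w) (w : E) :
    Integrable (fun ω => Φ (w, ω)) (sphereMeasure : Measure (sphere (0 : E) 1)) := by
  haveI := isFiniteMeasure_sphereMeasure (E := E)
  exact (integrable_const (K w)).mono' (hΦ.comp measurable_prodMk_left).aestronglyMeasurable
    (Eventually.of_forall fun ω => by rw [Real.norm_eq_abs]; exact hle w ω)

/-- `(1 + |w|) e^{|w|²/4}` is integrable against the Maxwellian `M dw = stdGaussian E`
(`M(w) (1 + |w|) e^{|w|²/4} = (2π)^{-d/2} (1 + |w|) e^{-|w|²/4}`). [folklore] -/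
theorem integrable_one_add_norm_mul_exp_sq_div_four_stdGaussian :
    Integrable (fun w : E => (1 + ‖w‖) * Real.exp (‖w‖ ^ 2 / 4)) (stdGaussian E) := by
  have hM : Measurable fun v : E => ENNReal.ofReal (globalMaxwellian v) :=
    continuous_globalMaxwellian.measurable.ennreal_ofReal
  rw [stdGaussian_eq_withDensity_globalMaxwellian_holds,
    integrable_withDensity_iff hM (Eventually.of_forall fun _ => ENNReal.ofReal_lt_top)]
  have h := (integrable_one_add_norm_mul_exp (E := E) (β := 1 / 2) (by norm_num)).const_mul
    ((2 * π) ^ (-(finrank ℝ E : ℝ) / 2))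
  refine h.congr (Eventually.of_forall fun w => ?_)
  simp only [globalMaxwellian]
  rw [ENNReal.toReal_ofReal (by positivity)]
  have hexp : Real.exp (‖w‖ ^ 2 / 4) * ((2 * π) ^ (-(finrank ℝ E : ℝ) / 2) * Real.exp (-‖w‖ ^ 2 / 2)) =
      (2 * π) ^ (-(finrank ℝ E : ℝ) / 2) * Real.exp (-(1 / 2 / 2) * ‖w‖ ^ 2) := by
    rw [mul_left_comm, ← Real.exp_add]
    congr 2
    ring
  rw [mul_assoc (1 + ‖w‖), hexp]
  ring

/-- A measurable integrand on `E × S^{d-1}` with `|Φ(w, ω)| ≤ C (1 + |w|) e^{|w|²/4}` has a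
`dM(w)`-integrable partial integral `w ↦ ∫ Φ(w, ω) dω`. [folklore] -/
theorem integrable_integral_sphere_of_gaussBound {Φ : E × sphere (0 : E) 1 → ℝ} (hΦ : Measurable Φ)
    {C : ℝ} (hle : ∀ w ω, |Φ (w, ω)| ≤ C * ((1 + ‖w‖) * Real.exp (‖w‖ ^ 2 / 4))) :
    Integrable (fun w => ∫ ω, Φ (w, ω) ∂(sphereMeasure : Measure (sphere (0 : E) 1)))
      (stdGaussian E) := by
  haveI := isFiniteMeasure_sphereMeasure (E := E)
  set S : ℝ := (sphereMeasure : Measure (sphere (0 : E) 1)).real univ with hS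
  have hsm : AEStronglyMeasurable (fun w =>
      ∫ ω, Φ (w, ω) ∂(sphereMeasure : Measure (sphere (0 : E) 1))) (stdGaussian E) :=
    (hΦ.stronglyMeasurable.integral_prod_right').aestronglyMeasurable
  refine ((integrable_one_add_norm_mul_exp_sq_div_four_stdGaussian (E := E)).const_mul (S * |C|)).mono'
    hsm (Eventually.of_forall fun w => ?_)
  have hbound : ∀ ω : sphere (0 : E) 1, ‖Φ (w, ω)‖ ≤ |C| * ((1 + ‖w‖) * Real.exp (‖w‖ ^ 2 / 4)) :=
    fun ω => by
      rw [Real.norm_eq_abs]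
      exact (hle w ω).trans (mul_le_mul_of_nonneg_right (le_abs_self C) (by positivity))
  calc ‖∫ ω, Φ (w, ω) ∂(sphereMeasure : Measure (sphere (0 : E) 1))‖
      ≤ ∫ _ : sphere (0 : E) 1, |C| * ((1 + ‖w‖) * Real.exp (‖w‖ ^ 2 / 4)) ∂sphereMeasure :=
        norm_integral_le_of_norm_le (integrable_const _) (Eventually.of_forall hbound)
    _ = S * |C| * ((1 + ‖w‖) * Real.exp (‖w‖ ^ 2 / 4)) := by
        rw [integral_const, smul_eq_mul, hS]; ring

/-! ### Energy conservation and the Gaussian growth of the kernel integrand -/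

omit [FiniteDimensional ℝ E] [MeasurableSpace E] [BorelSpace E] in
/-- `e^{|v'|²/4} ≤ e^{|v|²/4} e^{|v_*|²/4}` and the same for `v_*'` (conservation of energy).
[folklore] -/
theorem exp_norm_sq_collide_le (ω : sphere (0 : E) 1) (v w : E) :
    Real.exp (‖(collide ω (v, w)).1‖ ^ 2 / 4) ≤ Real.exp (‖v‖ ^ 2 / 4) * Real.exp (‖w‖ ^ 2 / 4) ∧
      Real.exp (‖(collide ω (v, w)).2‖ ^ 2 / 4) ≤ Real.exp (‖v‖ ^ 2 / 4) * Real.exp (‖w‖ ^ 2 / 4) := by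
  have h := norm_sq_collide_fst_add_norm_sq_collide_snd ω (v, w)
  simp only at h
  rw [← Real.exp_add]
  constructor
  · exact Real.exp_le_exp.2 (by nlinarith [sq_nonneg ‖(collide ω (v, w)).2‖])
  · exact Real.exp_le_exp.2 (by nlinarith [sq_nonneg ‖(collide ω (v, w)).1‖])

omit [FiniteDimensional ℝ E] [MeasurableSpace E] [BorelSpace E] in
/-- The kernel integrand of a function with Gaussian growth `|ψ| ≤ C e^{|·|²/4}` is bounded by
`3 C (1 + |v|) e^{|v|²/4} · (1 + |v_*|) e^{|v_*|²/4}`. [folklore] -/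
theorem abs_kernelIntegrand_le_of_gaussGrowth {ψ : E → ℝ} {C : ℝ} (hC0 : 0 ≤ C)
    (hC : ∀ x, |ψ x| ≤ C * Real.exp (‖x‖ ^ 2 / 4)) (v w : E) (ω : sphere (0 : E) 1) :
    |hardSphereKernel (v, w) ω * (ψ (collide ω (v, w)).1 + ψ (collide ω (v, w)).2 - ψ w)| ≤
      (3 * C * ((1 + ‖v‖) * Real.exp (‖v‖ ^ 2 / 4))) * ((1 + ‖w‖) * Real.exp (‖w‖ ^ 2 / 4)) := by
  obtain ⟨h1, h2⟩ := exp_norm_sq_collide_le ω v w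
  have hB0 : 0 ≤ hardSphereKernel (v, w) ω := le_max_right _ _
  have hB : hardSphereKernel (v, w) ω ≤ (1 + ‖v‖) * (1 + ‖w‖) := by
    refine (hardSphereKernel_le_abs_inner_add_norm v w ω).trans ?_
    nlinarith [abs_inner_sphere_le v ω, norm_nonneg v, norm_nonneg w,
      mul_nonneg (norm_nonneg v) (norm_nonneg w)]
  have hev : 1 ≤ Real.exp (‖v‖ ^ 2 / 4) := Real.one_le_exp (by positivity)
  have h3 : Real.exp (‖w‖ ^ 2 / 4) ≤ Real.exp (‖v‖ ^ 2 / 4) * Real.exp (‖w‖ ^ 2 / 4) :=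
    le_mul_of_one_le_left (Real.exp_nonneg _) hev
  have hsum : |ψ (collide ω (v, w)).1 + ψ (collide ω (v, w)).2 - ψ w| ≤
      3 * C * (Real.exp (‖v‖ ^ 2 / 4) * Real.exp (‖w‖ ^ 2 / 4)) := by
    have a1 := (hC _).trans (mul_le_mul_of_nonneg_left h1 hC0)
    have a2 := (hC _).trans (mul_le_mul_of_nonneg_left h2 hC0)
    have a3 := (hC w).trans (mul_le_mul_of_nonneg_left h3 hC0)
    calc |ψ (collide ω (v, w)).1 + ψ (collide ω (v, w)).2 - ψ w|
        ≤ |ψ (collide ω (v, w)).1| + |ψ (collide ω (v, w)).2| + |ψ w| :=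
          (abs_sub _ _).trans (add_le_add (abs_add_le _ _) le_rfl)
      _ ≤ _ := by linarith
  rw [abs_mul, abs_of_nonneg hB0]
  calc hardSphereKernel (v, w) ω * |ψ (collide ω (v, w)).1 + ψ (collide ω (v, w)).2 - ψ w|
      ≤ ((1 + ‖v‖) * (1 + ‖w‖)) * (3 * C * (Real.exp (‖v‖ ^ 2 / 4) * Real.exp (‖w‖ ^ 2 / 4))) :=
        mul_le_mul hB hsum (abs_nonneg _) (by positivity)
    _ = _ := by ring

/-! ### The splitting at every velocity -/

/-- **Grad's splitting for functions of Gaussian growth, at every velocity**: if `ψ` is measurable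
with `|ψ(x)| ≤ C e^{|x|²/4}`, then for every `v`,
`L ψ (v) = ∫∫ ((v - v_*)·ω)₊ (ψ(v') + ψ(v_*') - ψ(v_*)) dω dM(v_*) - ν(v) ψ(v)`, all integrals
being absolutely convergent (CIP 1994 §7.2 (2.14), here beyond temperate growth).
[cite: CIPDiluteGases1994, §7.2 (2.14)] -/
theorem hardSphereLinearizedOp_eq_kernel_sub_of_gaussGrowth {ψ : E → ℝ} (hψ : Measurable ψ)
    {C : ℝ} (hC : ∀ x, |ψ x| ≤ C * Real.exp (‖x‖ ^ 2 / 4)) (v : E) :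
    hardSphereLinearizedOp ψ v =
      (∫ w, ∫ ω, hardSphereKernel (v, w) ω *
          (ψ (collide ω (v, w)).1 + ψ (collide ω (v, w)).2 - ψ w) ∂sphereMeasure ∂stdGaussian E) -
        collisionFrequency v * ψ v := by
  have hC0 : 0 ≤ C := by
    have h := hC 0
    rw [norm_zero] at h
    norm_num at h
    exact (abs_nonneg _).trans h
  -- the two integrands and their bounds
  set Φ₁ : E × sphere (0 : E) 1 → ℝ := fun p => hardSphereKernel (v, p.1) p.2 *
    (ψ (collide p.2 (v, p.1)).1 + ψ (collide p.2 (v, p.1)).2 - ψ p.1) with hΦ₁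
  set Φ₀ : E × sphere (0 : E) 1 → ℝ := fun p => hardSphereKernel (v, p.1) p.2 with hΦ₀
  have hB : Continuous fun p : E × sphere (0 : E) 1 => hardSphereKernel (v, p.1) p.2 := by
    unfold hardSphereKernel; fun_prop
  have hc1 : Continuous fun p : E × sphere (0 : E) 1 => (collide p.2 (v, p.1)).1 := by
    unfold collide; fun_prop
  have hc2 : Continuous fun p : E × sphere (0 : E) 1 => (collide p.2 (v, p.1)).2 := by
    unfold collide; fun_prop
  have hΦ₁m : Measurable Φ₁ :=
    hB.measurable.mul (((hψ.comp hc1.measurable).add (hψ.comp hc2.measurable)).sub (hψ.comp measurable_fst))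
  have hΦ₀m : Measurable Φ₀ := hB.measurable
  have hΦ₁b : ∀ w ω, |Φ₁ (w, ω)| ≤ (3 * C * ((1 + ‖v‖) * Real.exp (‖v‖ ^ 2 / 4))) *
      ((1 + ‖w‖) * Real.exp (‖w‖ ^ 2 / 4)) := fun w ω =>
    abs_kernelIntegrand_le_of_gaussGrowth hC0 hC v w ω
  have hΦ₀b : ∀ w ω, |Φ₀ (w, ω)| ≤ (1 + ‖v‖) * ((1 + ‖w‖) * Real.exp (‖w‖ ^ 2 / 4)) := by
    intro w ω
    have hB0 : 0 ≤ hardSphereKernel (v, w) ω := le_max_right _ _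
    change |hardSphereKernel (v, w) ω| ≤ _
    rw [abs_of_nonneg hB0]
    refine (hardSphereKernel_le_abs_inner_add_norm v w ω).trans ?_
    have hew : 1 ≤ Real.exp (‖w‖ ^ 2 / 4) := Real.one_le_exp (by positivity)
    nlinarith [abs_inner_sphere_le v ω, norm_nonneg v, norm_nonneg w,
      mul_nonneg (mul_nonneg (by positivity : (0 : ℝ) ≤ 1 + ‖v‖) (by positivity : (0 : ℝ) ≤ 1 + ‖w‖))
        (sub_nonneg.2 hew)]
  have hinner : ∀ w, ∫ ω, hardSphereKernel (v, w) ω * (ψ (collide ω (v, w)).1 +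
      ψ (collide ω (v, w)).2 - ψ v - ψ w) ∂sphereMeasure =
      (∫ ω, Φ₁ (w, ω) ∂sphereMeasure) - ψ v * ∫ ω, Φ₀ (w, ω) ∂sphereMeasure := by
    intro w
    rw [← integral_const_mul, ← integral_sub (integrable_sphere_section_of_bound hΦ₁m hΦ₁b w)
      ((integrable_sphere_section_of_bound hΦ₀m hΦ₀b w).const_mul _)]
    refine integral_congr_ae (Eventually.of_forall fun ω => ?_)
    simp only [hΦ₁, hΦ₀]
    ring
  unfold hardSphereLinearizedOp linearizedCollisionOp
  rw [integral_congr_ae (Eventually.of_forall hinner), integral_sub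
    (integrable_integral_sphere_of_gaussBound hΦ₁m hΦ₁b)
    ((integrable_integral_sphere_of_gaussBound hΦ₀m hΦ₀b).const_mul _),
    integral_const_mul, collisionFrequency, mul_comm (ψ v)]

end

end Literature.Analysis.UnboundedOperators
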